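import Literature.MathematicalPhysics.KineticTheory.HardSphereEuler
import Literature.Analysis.FluidPDE.HardSphereTorusMeasure
import Literature.Analysis.FluidPDE.HardSphereRegularGeometry

/-!
# Free volume by sequential insertion: `Q_N(η) ≥ (1 - 4πη/3)^N` and `f_ex(η) ≤ -log(1 - 4πη/3)`

Negative-knowledge support for the crux `JParityClosure.LocalSecondLaw` (stmt-AtomisticToContinuum-13081), from
the standing disprover's `Cruxes/LocalSecondLaw/Disproof.lean` §(b): the first EXPLICIT upper bound in the tree
on the bare-`limsup` hard-sphere excess free energy `hsExcessFreeEnergy`.  `N` spheres of diameter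
`d = (η/N)^{1/3}` are inserted into `𝕋³` one at a time (Fubini over `Fin (n+1) → 𝕋³ ≃ᵐ 𝕋³ × (Fin n → 𝕋³)`,
`volume_preserving_piFinSuccAbove`); the last sphere must avoid at most `n` minimal-image balls of radius `d`,
of exact Haar volume `(4π/3)d³` each (`Torus.volume_euclidDist_le`, `d < 1/2`), so
`vol S_{n+1}(d) ≥ vol S_n(d) (1 - n (4π/3) d³)` (`volume_sepSet_succ_ge`) and `Q_N(η) ≥ (1 - 4πη/3)^N`
(`hsFreeVolume_ge`, `N ≥ 2`, `4πη/3 ≤ 1`); hence `-N⁻¹ log Q_N ≤ -log(1 - 4πη/3)` termwise and for the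
`limsup` (`hsExcessFreeEnergy_le`), with the numerical corollary `f_ex(σ³) ≤ 2` for `σ ≤ 1/2`
(`hsExcessFreeEnergy_le_two`) used by the witnesses of `LocalSecondLaw/Negative/`.  Complements
`LocalSecondLawNegative.hsExcessFreeEnergy_nonneg`.  refuter-cdisprove-stmt-AtomisticToContinuum-13081-0.
-/

noncomputable section

namespace Summit.AtomisticToContinuum.HydrodynamicLimit.Theorems.LocalSecondLawNegative

open MeasureTheory Filter Set Topology
open scoped ENNReal
open Literature.MathematicalPhysics.KineticTheory Literature.Analysis.FluidPDE

/-- Configurations of `n` points of `𝕋³` with pairwise minimal-image distances `> d`. [folklore] -/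
def sepSet (n : ℕ) (d : ℝ) : Set (Fin n → T3) :=
  {q | ∀ i j, i ≠ j → d < Torus.euclidDist (q i) (q j)}

/-- Continuity of the minimal-image distance along two continuous maps. [folklore] -/
theorem continuous_euclidDist_comp {α : Type*} [TopologicalSpace α] {f g : α → T3}
    (hf : Continuous f) (hg : Continuous g) : Continuous fun a => Torus.euclidDist (f a) (g a) := by
  show Continuous fun a => ‖Torus.reprSym (f a - g a)‖
  exact Torus.continuous_norm_reprSym.comp (hf.sub hg)

/-- The separated-configuration set is open. [folklore] -/
theorem isOpen_sepSet (n : ℕ) (d : ℝ) : IsOpen (sepSet n d) := by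
  have : sepSet n d = ⋂ i, ⋂ j, {q : Fin n → T3 | i ≠ j → d < Torus.euclidDist (q i) (q j)} := by
    ext q; simp [sepSet]
  rw [this]
  refine isOpen_iInter_of_finite fun i => isOpen_iInter_of_finite fun j => ?_
  by_cases hij : i = j
  · simp [hij]
  · simp only [ne_eq, hij, not_false_eq_true, forall_const]
    exact isOpen_lt continuous_const
      (continuous_euclidDist_comp (continuous_apply i) (continuous_apply j))

/-- Avoiding `n` balls: `vol {x | ∀ j, d < dist(x, q j)} ≥ 1 - n (4π/3) d³` for `0 ≤ d < 1/2`. [folklore] -/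
theorem volume_avoid_ge {n : ℕ} (q : Fin n → T3) {d : ℝ} (hd : 0 ≤ d) (hd2 : d < 1 / 2) :
    ENNReal.ofReal (1 - n * (4 * Real.pi / 3 * d ^ 3)) ≤
      volume {x : T3 | ∀ j, d < Torus.euclidDist x (q j)} := by
  have hAopen : IsOpen {x : T3 | ∀ j, d < Torus.euclidDist x (q j)} := by
    have : {x : T3 | ∀ j, d < Torus.euclidDist x (q j)} =
        ⋂ j, {x : T3 | d < Torus.euclidDist x (q j)} := by ext x; simp
    rw [this]
    exact isOpen_iInter_of_finite fun j => isOpen_lt continuous_const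
      (continuous_euclidDist_comp continuous_id continuous_const)
  have hball : ∀ j, volume {x : T3 | Torus.euclidDist x (q j) ≤ d} =
      ENNReal.ofReal (4 * Real.pi / 3 * d ^ 3) := by
    intro j
    rw [Torus.volume_euclidDist_le hd2 (q j), EuclideanSpace.volume_closedBall_fin_three,
      ← ENNReal.ofReal_pow hd, ← ENNReal.ofReal_mul (by positivity)]
    congr 1; ring
  have hcompl : volume {x : T3 | ∀ j, d < Torus.euclidDist x (q j)}ᶜ ≤
      ENNReal.ofReal (n * (4 * Real.pi / 3 * d ^ 3)) := by
    have hsub : {x : T3 | ∀ j, d < Torus.euclidDist x (q j)}ᶜ ⊆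
        ⋃ j, {x : T3 | Torus.euclidDist x (q j) ≤ d} := by
      intro x hx
      simp only [Set.mem_compl_iff, Set.mem_setOf_eq, not_forall, not_lt] at hx
      obtain ⟨j, hj⟩ := hx
      exact Set.mem_iUnion.2 ⟨j, hj⟩
    calc volume {x : T3 | ∀ j, d < Torus.euclidDist x (q j)}ᶜ
        ≤ volume (⋃ j, {x : T3 | Torus.euclidDist x (q j) ≤ d}) := measure_mono hsub
      _ ≤ ∑ j, volume {x : T3 | Torus.euclidDist x (q j) ≤ d} := measure_iUnion_fintype_le _ _
      _ = ∑ _j : Fin n, ENNReal.ofReal (4 * Real.pi / 3 * d ^ 3) := by simp_rw [hball]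
      _ = ENNReal.ofReal (n * (4 * Real.pi / 3 * d ^ 3)) := by
          rw [Finset.sum_const, Finset.card_univ, Fintype.card_fin, nsmul_eq_mul,
            ENNReal.ofReal_mul (Nat.cast_nonneg n), ENNReal.ofReal_natCast]
  have hsum := prob_add_prob_compl (μ := (volume : Measure T3)) hAopen.measurableSet
  have hA1 : volume {x : T3 | ∀ j, d < Torus.euclidDist x (q j)} =
      1 - volume {x : T3 | ∀ j, d < Torus.euclidDist x (q j)}ᶜ :=
    ENNReal.eq_sub_of_add_eq (measure_ne_top _ _) hsum
  rw [hA1, ENNReal.ofReal_sub _ (by positivity), ENNReal.ofReal_one]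
  exact tsub_le_tsub_left hcompl 1

/-- The slice description of `S_{n+1}` through `(x₀, rest)`. [folklore] -/
def sliceSet (n : ℕ) (d : ℝ) : Set (T3 × (Fin n → T3)) :=
  {p | p.2 ∈ sepSet n d ∧ ∀ j, d < Torus.euclidDist p.1 (p.2 j)}

/-- Sequential insertion: `vol S_{n+1}(d) ≥ vol S_n(d) · (1 - n (4π/3) d³)`. [folklore] -/
theorem volume_sepSet_succ_ge (n : ℕ) {d : ℝ} (hd : 0 ≤ d) (hd2 : d < 1 / 2) :
    volume (sepSet n d) * ENNReal.ofReal (1 - n * (4 * Real.pi / 3 * d ^ 3)) ≤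
      volume (sepSet (n + 1) d) := by
  let e := MeasurableEquiv.piFinSuccAbove (fun _ : Fin (n + 1) => T3) 0
  have hmp : MeasurePreserving e volume volume :=
    volume_preserving_piFinSuccAbove (fun _ : Fin (n + 1) => T3) 0
  have hT : sliceSet n d = {p | p.2 ∈ sepSet n d ∧ ∀ j, d < Torus.euclidDist p.1 (p.2 j)} := rfl
  have he1 : ∀ q : Fin (n + 1) → T3, (e q).1 = q 0 := fun q => rfl
  have he2 : ∀ (q : Fin (n + 1) → T3) (j : Fin n), (e q).2 j = q j.succ := fun q j => by
    show q (Fin.succAbove 0 j) = q j.succ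
    rw [Fin.succAbove_zero]
  have hpre : sepSet (n + 1) d = e ⁻¹' sliceSet n d := by
    ext q
    simp only [Set.mem_preimage, sliceSet, Set.mem_setOf_eq, sepSet, he1, he2]
    constructor
    · intro h
      exact ⟨fun i j hij => h _ _ (fun h' => hij (Fin.succ_injective _ h')),
        fun j => h 0 j.succ (Fin.succ_ne_zero j).symm⟩
    · rintro ⟨h2, h1⟩ i j hij
      rcases Fin.eq_zero_or_eq_succ i with rfl | ⟨i', rfl⟩ <;>
        rcases Fin.eq_zero_or_eq_succ j with rfl | ⟨j', rfl⟩
      · exact absurd rfl hij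
      · exact h1 j'
      · rw [Torus.euclidDist_comm]; exact h1 i'
      · exact h2 i' j' fun h' => hij (by rw [h'])
  have hTm : MeasurableSet (sliceSet n d) := by
    have h1 : MeasurableSet {p : T3 × (Fin n → T3) | p.2 ∈ sepSet n d} :=
      (isOpen_sepSet n d).measurableSet.preimage measurable_snd
    have h2 : MeasurableSet {p : T3 × (Fin n → T3) | ∀ j, d < Torus.euclidDist p.1 (p.2 j)} := by
      have : {p : T3 × (Fin n → T3) | ∀ j, d < Torus.euclidDist p.1 (p.2 j)} =
          ⋂ j, {p | d < Torus.euclidDist p.1 (p.2 j)} := by ext p; simp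
      rw [this]
      refine MeasurableSet.iInter fun j => (isOpen_lt continuous_const ?_).measurableSet
      exact continuous_euclidDist_comp continuous_fst ((continuous_apply j).comp continuous_snd)
    rw [hT, Set.setOf_and]
    exact h1.inter h2
  rw [hpre, hmp.measure_preimage hTm.nullMeasurableSet,
    show (volume : Measure (T3 × (Fin n → T3))) = volume.prod volume from rfl,
    Measure.prod_apply_symm hTm]
  have hslice : ∀ q : Fin n → T3, (sepSet n d).indicator
      (fun _ => ENNReal.ofReal (1 - n * (4 * Real.pi / 3 * d ^ 3))) q ≤
        volume ((fun x : T3 => (x, q)) ⁻¹' sliceSet n d) := by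
    intro q
    by_cases hq : q ∈ sepSet n d
    · rw [Set.indicator_of_mem hq]
      have : (fun x : T3 => (x, q)) ⁻¹' sliceSet n d = {x | ∀ j, d < Torus.euclidDist x (q j)} := by
        ext x; simp [sliceSet, hq]
      rw [this]
      exact volume_avoid_ge q hd hd2
    · rw [Set.indicator_of_notMem hq]
      exact zero_le
  calc volume (sepSet n d) * ENNReal.ofReal (1 - n * (4 * Real.pi / 3 * d ^ 3))
      = ∫⁻ q, (sepSet n d).indicator
          (fun _ => ENNReal.ofReal (1 - n * (4 * Real.pi / 3 * d ^ 3))) q := by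
        rw [lintegral_indicator_const (isOpen_sepSet n d).measurableSet, mul_comm]
    _ ≤ ∫⁻ q, volume ((fun x : T3 => (x, q)) ⁻¹' sliceSet n d) := lintegral_mono hslice

/-- Free-volume lower bound `vol S_n(d) ≥ (1 - m (4π/3) d³)^n` for `n ≤ m`. [folklore] -/
theorem volume_sepSet_ge {m : ℕ} {d : ℝ} (hd : 0 ≤ d) (hd2 : d < 1 / 2)
    (hm : m * (4 * Real.pi / 3 * d ^ 3) ≤ 1) :
    ∀ n, n ≤ m → ENNReal.ofReal ((1 - m * (4 * Real.pi / 3 * d ^ 3)) ^ n) ≤ volume (sepSet n d) := by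
  intro n
  induction n with
  | zero =>
    intro _
    have : sepSet 0 d = Set.univ := by
      ext q; simp [sepSet]
    rw [this, pow_zero, ENNReal.ofReal_one, measure_univ]
  | succ k ih =>
    intro hk
    have hk' : k ≤ m := Nat.le_of_succ_le hk
    have h0 : 0 ≤ 1 - m * (4 * Real.pi / 3 * d ^ 3) := by linarith
    have hkm : 1 - m * (4 * Real.pi / 3 * d ^ 3) ≤ 1 - k * (4 * Real.pi / 3 * d ^ 3) := by
      have : (k : ℝ) ≤ m := by exact_mod_cast hk'
      have : 0 ≤ 4 * Real.pi / 3 * d ^ 3 := by positivity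
      nlinarith
    calc ENNReal.ofReal ((1 - m * (4 * Real.pi / 3 * d ^ 3)) ^ (k + 1))
        = ENNReal.ofReal ((1 - m * (4 * Real.pi / 3 * d ^ 3)) ^ k) *
            ENNReal.ofReal (1 - m * (4 * Real.pi / 3 * d ^ 3)) := by
          rw [pow_succ, ENNReal.ofReal_mul (pow_nonneg h0 k)]
      _ ≤ volume (sepSet k d) * ENNReal.ofReal (1 - k * (4 * Real.pi / 3 * d ^ 3)) := by
          gcongr
          · exact ih hk'
      _ ≤ volume (sepSet (k + 1) d) := volume_sepSet_succ_ge k hd hd2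

/-! ## The explicit small-density bound on the excess free energy -/

/-- Every term of the `limsup` defining `f_ex` is non-negative (`Q_N ≤ 1`). [folklore] -/
theorem hsTerm_nonneg (η : ℝ) (n : ℕ) : 0 ≤ -(n : ℝ)⁻¹ * Real.log (hsFreeVolume η n) := by
  have h1 : Real.log (hsFreeVolume η n) ≤ 0 :=
    Real.log_nonpos ENNReal.toReal_nonneg (hsFreeVolume_le_one η n)
  have h2 : 0 ≤ (n : ℝ)⁻¹ := by positivity
  nlinarith

/-- **Free-volume lower bound** `Q_N(η) ≥ (1 - 4πη/3)^N` (`N ≥ 2`, `4πη/3 ≤ 1`): `N` spheres of diameter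
`(η/N)^{1/3}` inserted one at a time, each avoiding at most `N` balls of volume `(4π/3)(η/N)`. [folklore] -/
theorem hsFreeVolume_ge {η : ℝ} (hη0 : 0 ≤ η) (hη : 4 * Real.pi / 3 * η ≤ 1) {N : ℕ} (hN : 2 ≤ N) :
    (1 - 4 * Real.pi / 3 * η) ^ N ≤ hsFreeVolume η N := by
  have hNpos : 0 < (N : ℝ) := by exact_mod_cast (show 0 < N by omega)
  have hx0 : 0 ≤ η / N := by positivity
  have hd0 : 0 ≤ (η / N) ^ (1 / 3 : ℝ) := Real.rpow_nonneg hx0 _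
  have hd3 : ((η / N) ^ (1 / 3 : ℝ)) ^ 3 = η / N := by
    rw [one_div]; exact Real.rpow_inv_natCast_pow hx0 (by norm_num)
  have hpi := Real.pi_gt_three
  have hηsmall : η < 1 / 4 := by nlinarith
  have hd2 : (η / N) ^ (1 / 3 : ℝ) < 1 / 2 := by
    have h8 : ((η / N) ^ (1 / 3 : ℝ)) ^ 3 < (1 / 2 : ℝ) ^ 3 := by
      rw [hd3]
      have hN2 : (2 : ℝ) ≤ N := by exact_mod_cast hN
      have : η / N ≤ η / 2 := div_le_div_of_nonneg_left hη0 (by norm_num) hN2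
      nlinarith
    exact lt_of_pow_lt_pow_left₀ 3 (by norm_num) h8
  have hNc : (N : ℝ) * (4 * Real.pi / 3 * ((η / N) ^ (1 / 3 : ℝ)) ^ 3) = 4 * Real.pi / 3 * η := by
    rw [hd3]; field_simp
  have hm : (N : ℝ) * (4 * Real.pi / 3 * ((η / N) ^ (1 / 3 : ℝ)) ^ 3) ≤ 1 := by rw [hNc]; exact hη
  have h := volume_sepSet_ge hd0 hd2 hm N le_rfl
  rw [hNc] at h
  exact (ENNReal.ofReal_le_iff_le_toReal (measure_ne_top _ _)).1 h

/-- **Explicit small-density bound on the excess free energy**: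
`f_ex(η) ≤ -log(1 - 4πη/3)` for `0 ≤ η`, `4πη/3 < 1` (from `hsFreeVolume_ge`; in particular `f_ex`
is finite-valued where it matters and `f_ex(η) ≤ 2` for `η ≤ 3/(8π)`). [folklore] -/
theorem hsExcessFreeEnergy_le {η : ℝ} (hη0 : 0 ≤ η) (hη : 4 * Real.pi / 3 * η < 1) :
    hsExcessFreeEnergy η ≤ -Real.log (1 - 4 * Real.pi / 3 * η) := by
  unfold hsExcessFreeEnergy
  have hq : 0 < 1 - 4 * Real.pi / 3 * η := by linarith
  refine Filter.limsup_le_of_le (Filter.isCoboundedUnder_le_of_le atTop (x := 0) (hsTerm_nonneg η)) ?_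
  rw [Filter.eventually_atTop]
  refine ⟨2, fun N hN => ?_⟩
  have hV := hsFreeVolume_ge hη0 hη.le hN
  have hqN : 0 < (1 - 4 * Real.pi / 3 * η) ^ N := pow_pos hq N
  have hNpos : 0 < (N : ℝ) := by exact_mod_cast (show 0 < N by omega)
  have hlog : (N : ℝ) * Real.log (1 - 4 * Real.pi / 3 * η) ≤ Real.log (hsFreeVolume η N) := by
    rw [← Real.log_pow]; exact Real.log_le_log hqN hV
  have : Real.log (1 - 4 * Real.pi / 3 * η) ≤ (N : ℝ)⁻¹ * Real.log (hsFreeVolume η N) := by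
    rw [le_inv_mul_iff₀ hNpos]; exact hlog
  linarith

/-- Numerical corollary used by the witnesses: `f_ex(σ³) ≤ 2` for `0 ≤ σ ≤ 1/2`. [folklore] -/
theorem hsExcessFreeEnergy_le_two {σ : ℝ} (hσ0 : 0 ≤ σ) (hσ : σ ≤ 1 / 2) :
    hsExcessFreeEnergy (σ ^ 3) ≤ 2 := by
  have hpi3 := Real.pi_gt_three
  have hpi4 := Real.pi_le_four
  have hσ3 : σ ^ 3 ≤ 1 / 8 := by nlinarith [pow_le_pow_left₀ hσ0 hσ 3]
  have hx : 4 * Real.pi / 3 * σ ^ 3 ≤ 2 / 3 := by nlinarith [pow_nonneg hσ0 3]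
  have h1 := hsExcessFreeEnergy_le (pow_nonneg hσ0 3) (by linarith)
  have hpos : 0 < 1 - 4 * Real.pi / 3 * σ ^ 3 := by linarith
  have h2 : 1 - (1 - 4 * Real.pi / 3 * σ ^ 3)⁻¹ ≤ Real.log (1 - 4 * Real.pi / 3 * σ ^ 3) :=
    Real.one_sub_inv_le_log_of_pos hpos
  have h3 : (1 - 4 * Real.pi / 3 * σ ^ 3)⁻¹ ≤ 3 := by
    rw [inv_le_comm₀ hpos (by norm_num)]; linarith
  linarith

end Summit.AtomisticToContinuum.HydrodynamicLimit.Theorems.LocalSecondLawNegative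

end
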